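import Summits.BirchSwinnertonDyer.Rank1Residual.X5.SelmerSolitaireOnePrime
import Summits.BirchSwinnertonDyer.Rank1Residual.X5.SelmerSolitaireDecoration
import Summits.BirchSwinnertonDyer.Rank1Residual.X5.SelmerSolitairePivotExtend
import HarnessLib

/-!
# Selmer solitaire: the COVERED MOVE and the REBASED MOVE (the two engines of T4′)

Cell `b2b-bsdres`, O1 (p = 2) PROVER ORDER v2.8 (ii′) (x11b3-p4, R-G18.3 owner of T4′; plan
`HOME/b2b-bsdres-x11b3-p4/T4PRIME-PLAN.md` §3).  Pure 𝔽₂ linear algebra / cube combinatorics; theorems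
only; reach-neutral; nothing arithmetic asserted; nothing booked; no mark; O1 OPEN.

* `connected_empty_withNew_of_chain`, `connected_empty_lift_of_chain` — a T4-chain
  `{q}, {b₁,q}, …, B ∪ {q}` of cores (x11b3-p2's `exists_extend_chain`) is a PATH `∅ — … — B` in `𝒳⁰`
  of the extension.
* `exists_admissibleExtends` — a non-degenerate decoration (`A.Nonempty ∨ ε₀ = 1`) admits an admissible
  (dummy) move.
* **`exists_admissible_connected_of_cover`** (COVERED MOVE, lens-2 G5.9 covered case): if `A ⊄ B`
  (or `A = ∅, ε₀ = 1`) ONE admissible move connects `∅` to `B`: take p2's chain with `ψ = 0` and, if the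
  parity `N ⬝ c` is wrong, flip `N` at one `a ∈ A ∖ B` — the chain survives by LOCALITY
  (`core_extend_update_iff`, p2).
* `core_withNew_singleton` — `{b, q}` is core as soon as `q ∼ b` (the explicit first move of the
  uncovered case).
* `transportRow_leftInverse` — the row transformation `ν ↦ μ = ν𝟙_{Aᶜ} + Ŝ(ν𝟙_A)` inverts (R2)'s
  `μ ↦ ν = μ𝟙_{Aᶜ} + Ŝ′(μ𝟙_A)`.
* **`exists_admissible_connected_rebase`** (REBASED MOVE): the covered move performed in the position
  re-based at a core `C` and pulled back along (R2) `pivotPos_extend` / (R3) `admissible_transport`: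
  ONE admissible move (for the ORIGINAL decoration) connecting `C` to `m ∆ C` whenever
  `A ∆ C ⊄ m` (or the root alternative).
* `rebase_eps_eq_one_of_root` — re-basing at `A` itself (when `A` is core) gives `ε′ = 1`.

References: lens-2 GEN 5/9, ROUTES-O1 §lens-2 G5.3 (T4), G5.9 (T4′); B. Mazur, K. Rubin, *Kolyvagin
systems* (2004) §4.3; M. J. Tsatsomeros, LAA 307 (2000). [cite: MazurRubin2004, §4.3]
[cite: Tsatsomeros2000, Thm. 3.1]
-/

namespace Summit.BirchSwinnertonDyer.Rank1Residual.X5.SelmerSolitaire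

open Finset Matrix

variable {s : ℕ}

/-! ## Small facts on the cube `𝒳⁰` -/

/-- The base vertex is core. [folklore] -/
theorem core_empty (P : Position s) : Core P ∅ := by
  unfold Core
  have h : plus (∅ : Finset (Fin s)) = ∅ := by simp [plus]
  haveI : IsEmpty ↥(plus (∅ : Finset (Fin s))) := by rw [h]; infer_instance
  exact Matrix.det_isEmpty

/-- Cube adjacency is symmetric. [folklore] -/
theorem cubeAdj_symm {P : Position s} {n m : Finset (Fin s)} (h : CubeAdj P n m) : CubeAdj P m n :=
  ⟨h.2.1, h.1, h.2.2.symm⟩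

/-- Connectivity is symmetric. [folklore] -/
theorem connected_symm {P : Position s} {n m : Finset (Fin s)} (h : Connected P n m) : Connected P m n := by
  unfold Connected at h ⊢
  induction h with
  | refl => exact Relation.ReflTransGen.refl
  | tail _ hbc ih => exact Relation.ReflTransGen.head (cubeAdj_symm hbc) ih

/-- Connectivity is transitive. [folklore] -/
theorem connected_trans {P : Position s} {n m k : Finset (Fin s)} (h₁ : Connected P n m)
    (h₂ : Connected P m k) : Connected P n k :=
  Relation.ReflTransGen.trans h₁ h₂

/-- Inserting one new element into a core with core result is an edge of `𝒳⁰`. [folklore] -/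
theorem cubeAdj_insert {P : Position s} {n : Finset (Fin s)} {x : Fin s} (hx : x ∉ n) (hn : Core P n)
    (hnx : Core P (insert x n)) : CubeAdj P n (insert x n) := by
  refine ⟨hn, hnx, Or.inl ⟨Finset.subset_insert x n, ?_⟩⟩
  rw [Finset.insert_sdiff_of_notMem n hx, Finset.sdiff_self, Finset.insert_empty, Finset.card_singleton]

/-- `lift ∅ = ∅`. [folklore] -/
theorem lift_empty : lift (∅ : Finset (Fin s)) = ∅ := by
  unfold lift; exact Finset.map_empty _

/-- `i.castSucc ∈ lift n ↔ i ∈ n`. [folklore] -/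
theorem castSucc_mem_lift_iff (n : Finset (Fin s)) (i : Fin s) : i.castSucc ∈ lift n ↔ i ∈ n := by
  unfold lift
  exact Finset.mem_map' Fin.castSuccEmb

/-- The new index is not in a lifted set. [folklore] -/
theorem last_not_mem_lift (n : Finset (Fin s)) : Fin.last s ∉ lift n := by
  unfold lift
  rw [Finset.mem_map]
  rintro ⟨i, -, hi⟩
  exact Fin.castSucc_ne_last i hi

/-- `withNew ∅ = {q}`. [folklore] -/
theorem withNew_empty : withNew (∅ : Finset (Fin s)) = insert (Fin.last s) ∅ := by
  unfold withNew; rw [lift_empty]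

/-- `withNew (insert x T) = insert x (withNew T)`. [folklore] -/
theorem withNew_insert (x : Fin s) (T : Finset (Fin s)) :
    withNew (insert x T) = insert x.castSucc (withNew T) := by
  unfold withNew lift
  rw [Finset.map_insert, Finset.insert_comm]
  rfl

/-- `x ∉ T ⟹ x ∉ withNew T` (as an old index). [folklore] -/
theorem castSucc_not_mem_withNew {x : Fin s} {T : Finset (Fin s)} (hx : x ∉ T) :
    x.castSucc ∉ withNew T := by
  unfold withNew
  rw [Finset.mem_insert, castSucc_mem_lift_iff]
  rintro (h | h)
  · exact Fin.castSucc_ne_last x h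
  · exact hx h

/-! ## A T4-chain is a path in `𝒳⁰` -/

/-- **A chain `{q}, {b₁,q}, …` of cores is a path from `∅` in `𝒳⁰`.** [cite: MazurRubin2004, §4.3] -/
theorem connected_empty_withNew_of_chain (P' : Position (s + 1)) (l : List (Fin s)) (hl : l.Nodup)
    (hchain : ∀ i ≤ l.length, Core P' (withNew (l.take i).toFinset)) :
    Connected P' ∅ (withNew l.toFinset) := by
  classical
  induction l using List.reverseRecOn with
  | nil =>
    have h0 := hchain 0 le_rfl
    rw [List.take_zero, List.toFinset_nil] at h0
    rw [List.toFinset_nil, withNew_empty]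
    refine Relation.ReflTransGen.single (cubeAdj_insert (Finset.notMem_empty _) (core_empty P') ?_)
    rwa [withNew_empty] at h0
  | append_singleton l x ih =>
    have hl' : l.Nodup := (List.nodup_append.mp hl).1
    have hxl : x ∉ l := fun h => (List.nodup_append.mp hl).2.2 x h x (List.mem_singleton_self x) rfl
    have hchain' : ∀ i ≤ l.length, Core P' (withNew (l.take i).toFinset) := fun i hi => by
      have h := hchain i (by rw [List.length_append]; omega)
      rwa [List.take_append_of_le_length hi] at h
    have hconn := ih hl' hchain'
    have hlast := hchain (l ++ [x]).length le_rfl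
    rw [List.take_length] at hlast
    have heq : (l ++ [x]).toFinset = insert x l.toFinset := by
      rw [List.toFinset_append, List.toFinset_cons, List.toFinset_nil, Finset.insert_empty,
        Finset.union_comm, ← Finset.insert_eq]
    rw [heq, withNew_insert] at hlast ⊢
    refine Relation.ReflTransGen.tail hconn (cubeAdj_insert ?_ ?_ hlast)
    · exact castSucc_not_mem_withNew (fun h => hxl (List.mem_toFinset.mp h))
    · have h := hchain' l.length le_rfl
      rwa [List.take_length] at h

/-- **… and one more edge `B ∪ {q} — B` reaches `lift B`.** [cite: MazurRubin2004, §4.3] -/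
theorem connected_empty_lift_of_chain (P' : Position (s + 1)) (B : Finset (Fin s))
    (hB : Core P' (lift B)) (l : List (Fin s)) (hl : l.Nodup) (hlB : l.toFinset = B)
    (hchain : ∀ i ≤ l.length, Core P' (withNew (l.take i).toFinset)) :
    Connected P' ∅ (lift B) := by
  classical
  have h1 := connected_empty_withNew_of_chain P' l hl hchain
  rw [hlB] at h1
  have hlast := hchain l.length le_rfl
  rw [List.take_length, hlB] at hlast
  refine connected_trans h1 (Relation.ReflTransGen.single (cubeAdj_symm ?_))
  have h : withNew B = insert (Fin.last s) (lift B) := rfl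
  rw [h] at hlast ⊢
  exact cubeAdj_insert (last_not_mem_lift B) hB hlast

/-! ## Admissible moves: dummies and the covered move -/

/-- **A non-degenerate decoration admits an admissible move** (`q ∼ a` for some `a ∈ A`, or `q ∼ ∞`
when `ε₀ = 1`). [cite: MazurRubin2004, §4.3] -/
theorem exists_admissibleExtends (P : Position s) {A : Finset (Fin s)} {ε₀ : ZMod 2}
    (hne : A.Nonempty ∨ ε₀ = 1) : ∃ N : V s → ZMod 2, AdmissibleExtends P A ε₀ (extend P N) := by
  classical
  rcases hne with ⟨a, ha⟩ | h1
  · refine ⟨Pi.single (some a) 1, ?_⟩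
    rw [admissibleExtends_extend_iff, single_dotProduct, one_mul, decVec_some, if_pos ha]
  · refine ⟨Pi.single none 1, ?_⟩
    rw [admissibleExtends_extend_iff, single_dotProduct, one_mul, decVec_none, h1]

/-- Flipping one coordinate: `update N v (N v + 1) = N + e_v`. [folklore] -/
theorem update_add_one_eq (N : V s → ZMod 2) (v : V s) :
    Function.update N v (N v + 1) = N + Pi.single v 1 := by
  classical
  funext w
  by_cases hw : w = v
  · subst hw
    rw [Function.update_self, Pi.add_apply, Pi.single_eq_same]
  · rw [Function.update_of_ne hw, Pi.add_apply, Pi.single_eq_of_ne hw, add_zero]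

/-- **THE COVERED MOVE** (lens-2 G5.9, covered case, with p2's strong T4 and locality): if `A ⊄ B`, or
`A = ∅` and `ε₀ = 1`, then ONE admissible move connects `∅` to `B` in `𝒳⁰`. [cite: MazurRubin2004, §4.3] -/
theorem exists_admissible_connected_of_cover (P : Position s) {A : Finset (Fin s)} {ε₀ : ZMod 2}
    {B : Finset (Fin s)} (hB : Core P B) (hcov : ¬ A ⊆ B ∨ (A = ∅ ∧ ε₀ = 1)) :
    ∃ N : V s → ZMod 2, AdmissibleExtends P A ε₀ (extend P N) ∧ Connected (extend P N) ∅ (lift B) := by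
  classical
  obtain ⟨N₀, hN₀, -, l, hl, hlB, hchain⟩ := exists_extend_chain P B hB 0
  -- an admissible `N` with the same chain
  have key : ∃ N : V s → ZMod 2, N ⬝ᵥ decVec A ε₀ = 1 ∧
      ∀ i ≤ l.length, Core (extend P N) (withNew (l.take i).toFinset) := by
    by_cases hadm : N₀ ⬝ᵥ decVec A ε₀ = 1
    · exact ⟨N₀, hadm, hchain⟩
    rcases hcov with hnsub | ⟨hA, hε⟩
    · obtain ⟨a, haA, haB⟩ := Finset.not_subset.mp hnsub
      refine ⟨Function.update N₀ (some a) (N₀ (some a) + 1), ?_, fun i hi => ?_⟩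
      · have h0 : N₀ ⬝ᵥ decVec A ε₀ = 0 := by
          by_contra h0
          exact hadm ((Alt.eq_one_iff_ne_zero _).mpr h0)
        rw [update_add_one_eq, add_dotProduct, single_dotProduct, one_mul, decVec_some, if_pos haA,
          h0, zero_add]
      · have haT : a ∉ (l.take i).toFinset := fun h => haB (by
          rw [← hlB, List.mem_toFinset]
          exact (List.take_sublist i l).subset (List.mem_toFinset.mp h))
        exact (core_extend_update_iff P N₀ haT _).mpr (hchain i hi)
    · exfalso
      apply hadm
      subst hA
      simp only [dotProduct]
      rw [Fintype.sum_option, decVec_none, hε, hN₀, one_mul]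
      simp [decVec_some]
  obtain ⟨N, hN, hchainN⟩ := key
  refine ⟨N, (admissibleExtends_extend_iff P A ε₀ N).mpr hN, ?_⟩
  exact connected_empty_lift_of_chain (extend P N) B ((core_extend_lift_iff P N B).mpr hB) l hl hlB hchainN

/-! ## The explicit first move of the uncovered case: `{b, q}` is core if `q ∼ b` -/

/-- **`{b, q}` is core in `extend P N` as soon as `N b = 1`** (the minor is `[[0,1],[1,0]]`).
[folklore] -/
theorem core_withNew_singleton (P : Position s) (N : V s → ZMod 2) {b : Fin s} (hb : N (some b) = 1) :
    Core (extend P N) (withNew {b}) := by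
  classical
  set S' := (extend P N).S with hS'
  set q : V (s + 1) := some (Fin.last s) with hq
  set p : V (s + 1) := oldV (some b) with hp
  have hpq : p ≠ q := oldV_ne_new _
  have hXdet : (S'.submatrix (Subtype.val : ↥(∅ : Finset (V (s + 1))) → V (s + 1))
      Subtype.val).det ≠ 0 := by
    haveI : IsEmpty ↥(∅ : Finset (V (s + 1))) := ⟨fun x => Finset.notMem_empty x.1 x.2⟩
    rw [Matrix.det_isEmpty]
    exact one_ne_zero
  have h0X : ∀ i, i ∉ (∅ : Finset (V (s + 1))) → (0 : V (s + 1) → ZMod 2) i = 0 := fun _ _ => rfl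
  have h0 : ∀ (c : V (s + 1)), ∀ i ∈ (∅ : Finset (V (s + 1))), (S' *ᵥ 0) i = S' i c :=
    fun c i hi => absurd hi (Finset.notMem_empty i)
  have key := Alt.det_insert_insert_eq_one_iff (extend P N).symm (extend P N).loopless
    (Finset.notMem_empty p) (Finset.notMem_empty q) hpq hXdet h0X (h0 p) h0X (h0 q)
  have hplus : plus (withNew ({b} : Finset (Fin s))) = insert q (insert p ∅) := by
    rw [plus_withNew_eq_of_mem (Finset.mem_singleton_self b), Finset.erase_singleton]
    have h : plus (∅ : Finset (Fin s)) = ∅ := by simp [plus]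
    rw [h, Finset.image_empty]
  unfold Core
  rw [hplus, Finset.insert_comm]
  refine key.mpr ?_
  rw [Matrix.mulVec_zero, Pi.zero_apply, add_zero, hq, hp, extend_S_new_oldV, hb]

/-! ## The rebased move -/

/-- **The row transformation of (R2) is inverted by `ν ↦ ν𝟙_{Aᶜ} + Ŝ(ν𝟙_A)`** (exchange relation, char 2).
[cite: Tsatsomeros2000, Thm. 3.1] -/
theorem transportRow_leftInverse (P : Position s) (X : Finset (Fin s)) (hX : Core P X)
    (ν : V s → ZMod 2) :
    (fun v => (plus X).piecewise 0
        (fun w => (plus X).piecewise 0 ν w + (P.S *ᵥ (plus X).piecewise ν 0) w) v +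
      (pivot P.S (plus X) *ᵥ (plus X).piecewise
        (fun w => (plus X).piecewise 0 ν w + (P.S *ᵥ (plus X).piecewise ν 0) w) 0) v) = ν := by
  classical
  set A := plus X with hA
  set z : V s → ZMod 2 := A.piecewise ν 0 with hz
  have hμA : A.piecewise (fun w => A.piecewise 0 ν w + (P.S *ᵥ z) w) 0 = A.piecewise (P.S *ᵥ z) z := by
    funext i
    by_cases hi : i ∈ A
    · rw [Finset.piecewise_eq_of_mem _ _ _ hi, Finset.piecewise_eq_of_mem _ _ _ hi,
        Finset.piecewise_eq_of_mem _ _ _ hi, Pi.zero_apply, zero_add]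
    · rw [Finset.piecewise_eq_of_notMem _ _ _ hi, Finset.piecewise_eq_of_notMem _ _ _ hi, hz,
        Finset.piecewise_eq_of_notMem _ _ _ hi, Pi.zero_apply]
  have hex := pivot_mulVec_piecewise (isUnit_det_of_core P X hX) z
  funext v
  rw [hμA, hex]
  by_cases hv : v ∈ A
  · rw [Finset.piecewise_eq_of_mem _ _ _ hv, Finset.piecewise_eq_of_mem _ _ _ hv, hz,
      Finset.piecewise_eq_of_mem _ _ _ hv, Pi.zero_apply, zero_add]
  · rw [Finset.piecewise_eq_of_notMem _ _ _ hv, Finset.piecewise_eq_of_notMem _ _ _ hv,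
      Finset.piecewise_eq_of_notMem _ _ _ hv, add_assoc, CharTwo.add_self_eq_zero, add_zero]

/-- `∅ ∆ n = n`. [folklore] -/
theorem empty_symmDiff (n : Finset (Fin s)) : symmDiff (∅ : Finset (Fin s)) n = n :=
  bot_symmDiff n

/-- **THE REBASED MOVE**: for a consistent decoration `(A₀, ε₀)`, a core `C` and a vertex `m` with
`m ∆ C` core, if `A₀ ∆ C ⊄ m` (or `A₀ ∆ C = ∅` and `ε′ = 1`) then ONE admissible move (for the ORIGINAL
decoration) connects `C` to `m ∆ C` in `𝒳⁰` of the extension — the covered move of the position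
re-based at `C`, pulled back along (R2)/(R3). [cite: MazurRubin2004, §4.3] -/
theorem exists_admissible_connected_rebase (P : Position s) {A₀ : Finset (Fin s)} {ε₀ : ZMod 2}
    (hc : Bad1Consistent P A₀ ε₀) (C : Finset (Fin s)) (hC : Core P C) (m : Finset (Fin s))
    (hm : Core P (symmDiff m C))
    (hcov : ¬ symmDiff A₀ C ⊆ m ∨
      (symmDiff A₀ C = ∅ ∧ (if Even C.card then ε₀ else ∑ a ∈ A₀, P.S none (some a)) = 1)) :
    ∃ N : V s → ZMod 2, AdmissibleExtends P A₀ ε₀ (extend P N) ∧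
      Connected (extend P N) (lift C) (symmDiff (lift m) (lift C)) := by
  classical
  have hmR : Core (pivotPos P C hC) m := (core_pivotPos_iff P C hC m).mpr hm
  obtain ⟨ν, hadm, hconn⟩ := exists_admissible_connected_of_cover (pivotPos P C hC) hmR hcov
  set μ : V s → ZMod 2 := fun v => (plus C).piecewise 0 ν v + (P.S *ᵥ (plus C).piecewise ν 0) v
    with hμ
  have hinv : (fun v => (plus C).piecewise 0 μ v + (pivot P.S (plus C) *ᵥ (plus C).piecewise μ 0) v) = ν :=
    transportRow_leftInverse P C hC ν
  refine ⟨μ, ?_, ?_⟩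
  · refine (admissible_transport P A₀ ε₀ C hC hc μ).mpr ?_
    rw [hinv]
    exact hadm
  · have hX' : Core (extend P μ) (lift C) := (core_extend_lift_iff P μ C).mpr hC
    have hpe := pivotPos_extend P C hC μ hX'
    rw [hinv] at hpe
    rw [← hpe] at hconn
    have h2 := (connected_pivotPos_iff (extend P μ) (lift C) hX' ∅ (lift m)).mp hconn
    rwa [empty_symmDiff] at h2

/-- **Re-basing at `A` itself gives `ε′ = 1`** (the transported decoration `(∅, ε′)` is consistent, and
`D ≠ ∅`). [cite: MazurRubin2004, §4.3] -/
theorem rebase_eps_eq_one_of_root (P : Position s) {A : Finset (Fin s)} {ε₀ : ZMod 2}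
    (hc : Bad1Consistent P A ε₀) (hA : Core P A) (hne : A.Nonempty) :
    (if Even A.card then ε₀ else ∑ a ∈ A, P.S none (some a)) = 1 := by
  classical
  have h := bad1Consistent_pivotPos P A ε₀ A hA hc
  rw [symmDiff_self] at h
  obtain ⟨a, -⟩ := hne
  have ha := h a
  rw [Finset.bot_eq_empty, Finset.sum_empty, zero_add, if_neg (Finset.notMem_empty a)] at ha
  by_contra hne1
  have h0 : (if Even A.card then ε₀ else ∑ a ∈ A, P.S none (some a)) = 0 := by
    by_contra h0
    exact hne1 ((Alt.eq_one_iff_ne_zero _).mpr h0)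
  rw [h0, zero_mul] at ha
  exact zero_ne_one ha

end Summit.BirchSwinnertonDyer.Rank1Residual.X5.SelmerSolitaire
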